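import Summits.FinalStateConjecture.FinalStateConjecture.Theses.EIHFluxBalance
import Summits.FinalStateConjecture.FinalStateConjecture.Theorems.WeakCosmicCensorshipTame.Negative.LoadBearing
import Literature.Geometry.Lorentzian.TameGenericityDiagonal
import Literature.Geometry.Lorentzian.TrivialDataAdmissible

/-!
# `ModulatedKerrHandoff` H′ (crux `stmt-FinalStateConjecture-17402`, route EIHFluxBalance, rank 3) —
# negative-side lemmas II: read-back of the re-typed crux, exact refutation shape, and the
# load-bearing hypotheses AT THE CRUX'S OWN PROPERTY

Refuter seat `refuter-cdisprove-stmt-FinalStateConjecture-17402-0` (standing disprover of the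
re-typed crux H′, cycle 1, 2026-08-17; workfile `Cruxes/ModulatedKerrHandoff/Disproof.lean`;
companion of the def-free `Negative/LoadBearing.lean`, which states the transfer lemmas for a general
property). Nothing here closes the item: kernel-checked NEGATIVE-SIDE lemmas (cdisprove protocol
(a)–(c)), `sorry`-free, no named fact. Two parametrised predicates are isolated for read-back, exactly
as `UniversalWitnessFamily/Negative/Readback.lean` does for its crux: `HandoffN 𝒟 N` — the
sixteen-clause modulated multi-Kerr–Schild ansatz with `N` holes INCLUDING the four handoff clauses
(T), (O), (R), (QS) of rev 6, verbatim the `∃`-block of the crux with `N` pulled out (= the antecedent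
of the sibling crux `InertialRecession`, 17403) — and `HandoffProp X D`, the property whose tame
genericity H′ asserts; `modulatedKerrHandoff_iff` is `Iff.rfl`.

* §0 `modulatedKerrHandoff_iff`, `wccProp_of_handoffProp`.
* §1 SHAPE: `not_modulatedKerrHandoff_iff_exists_trapped` — `¬H′` is: some `Σ`, an admissible datum
  `d` failing `HandoffProp`, and a TRAP — every tame, immersed, injective curve of admissible data
  through `d` fails `HandoffProp` again at a nonzero parameter; `not_modulatedKerrHandoff_of_forall_not`
  — a nonempty admissible class of exceptional data is such a trap (it still needs `¬HandoffProp d`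
  PROVED for concrete `d`: an MGHD in hand violating censorship / the ansatz / a handoff clause, or
  MGHD non-existence — neither is constructible in the tree);
  `exists_handoffProp_of_modulatedKerrHandoff`, `exists_isMaximal_handoffN_of_modulatedKerrHandoff`
  (H′ produces an MGHD of an admissible datum on `ℝ³` with the full sixteen-clause package: MGHD theory
  AND the asymptotic analysis are load-bearing).
* §2 LOAD-BEARING HYPOTHESES at `HandoffProp` (the mutated crux written out in each theorem's type):
  the vacuum-constraint clause (`modulatedKerrHandoff_false_without_constraints`, outright), `[T2Space Σ]`
  (`modulatedKerrHandoffWithoutT2_false_of`, modulo one non-Hausdorff admissible datum), `IsMaximal` in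
  the `∀`-clause (`trivialData_exceptional_without_isMaximal` outright,
  `modulatedKerrHandoff_false_without_isMaximal_of` modulo "every admissible datum on `ℝ³` has SOME
  development with incomplete `𝓘⁺`").
* §3 SCALE: `modulatedKerrHandoff_scale_zero` — codimension parameter `0` in place of `1` makes H′
  trivially TRUE; all content sits at `m = 1`.

## References

* D. Christodoulou, CQG 16 (1999) A23, p. A24 (admissible class; positive codimension) and
  pp. A26–A27 (complete `𝓘⁺`).
* Y. Choquet-Bruhat, R. Geroch, CMP 14 (1969) 329 (maximal developments).
* M. Dafermos, J. Luk, arXiv:1710.01722, §1.2.1 and Conjecture 1 (the final state picture).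
-/

noncomputable section

-- the doubled `FinalStateConjecture.FinalStateConjecture` path component trips dupNamespace
set_option linter.dupNamespace false

open Bundle TopologicalSpace Set Function Filter
open scoped Manifold ContDiff Topology BigOperators ENNReal

namespace Summit.FinalStateConjecture.FinalStateConjecture.Theorems.ModulatedKerrHandoff.Negative

open Literature.Geometry.Lorentzian
open Literature.Geometry.Lorentzian.InitialDataSet
  (IsTameDataFamily IsImmersedAtZero IsTameChristodoulouGeneric IsSmoothDataFamily)
open Summit.FinalStateConjecture.FinalStateConjecture.Theses.EIHFluxBalance (ModulatedKerrHandoff)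
open Summit.FinalStateConjecture.FinalStateConjecture.Theorems.WeakCosmicCensorshipMGHD.Negative
  (admissibleNoConstraint wcc_false_without_constraints wccWithoutT2_false_of
    exists_vacuumCauchyDevelopment_trivialData_not_complete)
open Summit.FinalStateConjecture.FinalStateConjecture.Theorems.WeakCosmicCensorshipTame.Negative
  (not_isTameGeneric_iff_exists_trapped not_isTameGeneric_of_forall_not
    isTameChristodoulouGeneric_admissible_zero)

/-! ## §0 Read-back -/

section Readback

variable {X : Type} [TopologicalSpace X] [ChartedSpace E3 X] [IsManifold (𝓡 3) ∞ X]
  [ConnectedSpace X] {D : InitialDataSet (𝓡 3) X}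

-- operator-norm instance paths on form-valued maps are slow to unify (clause (QS))
set_option synthInstance.maxHeartbeats 400000 in
/-- **The modulated multi-Kerr–Schild ansatz WITH HANDOFF, `N` holes** (verbatim the `∃`-block of the
crux H′ with the number of holes pulled out; = the antecedent of the sibling crux `InertialRecession`
E′, item 17403): sub-extremal parameters with cores `rinᵢ ∈ (r₋, r₊)` (1), Lorentz factors `≤ γ` (2),
smooth motions (3), pairwise separation (4), the cone clause (5), chart domain (6); and, over the
painted background `B`, a smooth lab chart (7) which is an open embedding on the late region (8), the
late exterior image inside `O` (9), `C³` deviation `→ 0` unweighted on whole slabs (10) and with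
weight `1 + d^{7/4}` inside the cone (10′), `O` the self-determined exterior (11), exhaustion (12),
and the four handoff clauses of rev 6: (T) eventual lab-time causality of the charted region, (O)
orthochronous painted frames, (R) `RaysStayInClosure 𝒟 O`, (QS) weighted quasi-stationarity of the
painted background. [cite: DafermosLuk2017, Conjecture 1] -/
def HandoffN (𝒟 : VacuumCauchyDevelopment D) (N : ℕ) : Prop :=
  ∃ (M a rin : Fin N → ℝ) (Λ : Fin N → ℝ → lorentzGroup) (ξ : Fin N → ℝ → E3) (γ κ τ₀ : ℝ) (U : Opens E4) (Φ : U → 𝒟.carrier) (O : Set 𝒟.carrier), (∀ i, Kerr.IsSubextremal (M i) (a i) ∧ Kerr.rMinus (M i) (a i) < rin i ∧ rin i < Kerr.rPlus (M i) (a i)) ∧ (∀ i t, |((Λ i t : E4 ≃L[ℝ] E4) (E4.basisVector 0)) 0| ≤ γ) ∧ (∀ i, ContDiff ℝ ((⊤ : ℕ∞) : WithTop ℕ∞) (ξ i) ∧ ContDiff ℝ ((⊤ : ℕ∞) : WithTop ℕ∞) (fun t ↦ ((Λ i t : E4 ≃L[ℝ] E4) : E4 →L[ℝ] E4))) ∧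 (∀ i j, i ≠ j → Tendsto (fun t ↦ ‖ξ i t - ξ j t‖) atTop atTop) ∧ (0 < κ ∧ κ < 1 ∧ ∀ i, ∀ᶠ t in atTop, ‖ξ i t‖ ≤ κ ^ 2 * t) ∧ ({x : E4 | τ₀ < x 0 ∧ ∀ i, rin i < Kerr.radius (a i) (poincareInv (Λ i (x 0)) (E4.ofTimeSpace (x 0) (ξ i (x 0))) x)} ⊆ (U : Set E4)) ∧ let B : ModelBackground := ⟨U, fun x ↦ Minkowski.bilin + ∑ i, (boostedKerrBilin (Λ i (x 0)) (E4.ofTimeSpace (x 0) (ξ i (x 0))) (M i) (a i) x - Minkowski.bilin), fun x ↦ x 0, E4.spatialNorm⟩; ContMDiff 𝓘(ℝ, E4) (𝓡 4) ((⊤ : ℕ∞) : WithTop ℕ∞) Φ ∧ Topology.IsOpenEmbedding ((B.lateRegion τ₀).restrict Φ) ∧ Φ '' {x : U | τ₀ < x.1 0 ∧ ∀ i, Kerr.rPlus (M i) (a i) < Kerr.radius (a i) (poincareInv (Λ i (x.1 0)) (E4.ofTimeSpace (x.1 0) (ξ i (x.1 0))) x.1)} ⊆ O ∧ Tendsto (fun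 t ↦ 𝒟.toSpacetime.deviationCk B Φ 3 t) atTop (𝓝 0) ∧ Tendsto (fun t : ℝ ↦ ⨆ x ∈ {x : U | x.1 0 = t ∧ E4.spatialNorm x.1 ≤ κ * t}, ⨆ (m : ℕ) (_ : m ≤ 3), ENNReal.ofReal (1 + √(√((⨅ i, ‖E4.spatial x.1 - ξ i t‖) ^ 7))) * ‖iteratedFDeriv ℝ m (𝒟.toSpacetime.deviationExtend B Φ) x.1‖ₑ) atTop (𝓝 0) ∧ O = Summit.FinalStateConjecture.exteriorOf 𝒟.toCauchyDevelopment (Φ '' {x : U | τ₀ < x.1 0 ∧ ∀ i, Kerr.rPlus (M i) (a i) < Kerr.radius (a i) (poincareInv (Λ i (x.1 0)) (E4.ofTimeSpace (x.1 0) (ξ i (x.1 0))) x.1)}) ∧ (∀ t₁ : ℝ, τ₀ < t₁ → O \ Φ '' {x : U | t₁ < x.1 0 ∧ ∀ i, Kerr.rPlus (M i) (a i) < Kerr.radius (a i) (poincareInv (Λ i (x.1 0)) (E4.ofTimeSpace (x.1 0) (ξ i (x.1 0))) x.1)} ⊆ 𝒟.metric.causalPast 𝒟.timeOrientation (Φ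 '' {x : U | x.1 0 = t₁ ∧ ∀ i, Kerr.rPlus (M i) (a i) < Kerr.radius (a i) (poincareInv (Λ i (x.1 0)) (E4.ofTimeSpace (x.1 0) (ξ i (x.1 0))) x.1)})) ∧ (∃ τ₁ : ℝ, ∀ x y : U, (τ₁ < x.1 0 ∧ ∀ i, rin i < Kerr.radius (a i) (poincareInv (Λ i (x.1 0)) (E4.ofTimeSpace (x.1 0) (ξ i (x.1 0))) x.1)) → (τ₁ < y.1 0 ∧ ∀ i, rin i < Kerr.radius (a i) (poincareInv (Λ i (y.1 0)) (E4.ofTimeSpace (y.1 0) (ξ i (y.1 0))) y.1)) → Φ y ∈ 𝒟.metric.causalFuture 𝒟.timeOrientation {Φ x} → x.1 0 ≤ y.1 0) ∧ (∀ (i : Fin N) (t : ℝ), 0 < (((Λ i t : lorentzGroup) : E4 ≃L[ℝ] E4) (E4.basisVector 0)) 0) ∧ Summit.FinalStateConjecture.RaysStayInClosure 𝒟.toCauchyDevelopment O ∧ (∀ ρ : ℝ → ℝ, Tendsto ρ atTop atTop → Tendsto (fun t : ℝ ↦ ⨆ x ∈ {x : E4 | x 0 = t ∧ E4.spatialNorm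 x ≤ κ * t ∧ ρ t ≤ ⨅ i, ‖E4.spatial x - ξ i t‖}, ENNReal.ofReal (1 + √(√((⨅ i, ‖E4.spatial x - ξ i t‖) ^ 7))) * ‖fderiv ℝ (fun y : E4 ↦ Minkowski.bilin + ∑ i, (boostedKerrBilin (Λ i (y 0)) (E4.ofTimeSpace (y 0) (ξ i (y 0))) (M i) (a i) y - Minkowski.bilin)) x (E4.basisVector 0)‖ₑ) atTop (𝓝 0))

variable (X) in
/-- **The property of an admissible datum whose TAME Christodoulou-genericity the crux H′ asserts**:
an MGHD exists, and every MGHD has complete `𝓘⁺` (sojourn form) AND carries the modulated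
multi-Kerr–Schild ansatz with handoff for some number of holes. [cite: DafermosLuk2017, Conjecture 1] -/
def HandoffProp (D : InitialDataSet (𝓡 3) X) : Prop :=
  (∃ 𝒟 : VacuumCauchyDevelopment D, 𝒟.IsMaximal) ∧
    ∀ 𝒟 : VacuumCauchyDevelopment D, 𝒟.IsMaximal →
      _root_.Summit.FinalStateConjecture.HasCompleteNullInfinity 𝒟.toCauchyDevelopment ∧
        ∃ N, HandoffN 𝒟 N

/-- `HandoffProp` refines the censored property of the sibling cruxes `WeakCosmicCensorshipMGHD` /
`WeakCosmicCensorshipTame` pointwise. [folklore] -/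
theorem wccProp_of_handoffProp {D : InitialDataSet (𝓡 3) X} (h : HandoffProp X D) :
    (∃ 𝒟 : VacuumCauchyDevelopment D, 𝒟.IsMaximal) ∧
      ∀ 𝒟 : VacuumCauchyDevelopment D, 𝒟.IsMaximal →
        _root_.Summit.FinalStateConjecture.HasCompleteNullInfinity 𝒟.toCauchyDevelopment :=
  ⟨h.1, fun 𝒟 h𝒟 ↦ (h.2 𝒟 h𝒟).1⟩

end Readback

/-- **FAITHFULNESS**: the crux H′ is literally
`∀ Σ, IsTameChristodoulouGeneric (admissibleVacuumData Σ) HandoffProp 1`. [folklore] -/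
theorem modulatedKerrHandoff_iff :
    ModulatedKerrHandoff ↔
      ∀ (X : Type) [TopologicalSpace X] [ChartedSpace E3 X] [IsManifold (𝓡 3) ∞ X] [T2Space X]
        [SecondCountableTopology X] [ConnectedSpace X],
        IsTameChristodoulouGeneric (admissibleVacuumData X) (HandoffProp X) 1 :=
  Iff.rfl

/-! ## §1 The exact shape of a refutation -/

/-- **EXACT SHAPE OF `¬H′`**: a data manifold `Σ`, an admissible datum `d` on it failing
`HandoffProp`, and a TRAP — every TAME (on some end), immersed, injective curve of admissible data
through `d` fails `HandoffProp` again at some nonzero parameter. Both halves are out of reach in the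
tree: `¬ HandoffProp d` needs an MGHD of `d` IN HAND violating censorship / the ansatz / a handoff
clause (or MGHD non-existence), and the trap must defeat composite tame witnesses (local cure ⊕
Kerr-end trimming at a free receding radius, cf. `not_isImmersedAtZero_of_eventuallyEq` of
`Negative/LoadBearing.lean`).
[cite: Christodoulou1999, p. A24] -/
theorem not_modulatedKerrHandoff_iff_exists_trapped :
    ¬ ModulatedKerrHandoff ↔
      ∃ (X : Type) (_ : TopologicalSpace X) (_ : ChartedSpace E3 X) (_ : IsManifold (𝓡 3) ∞ X)
        (_ : T2Space X) (_ : SecondCountableTopology X) (_ : ConnectedSpace X),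
        ∃ d ∈ admissibleVacuumData X, ¬ HandoffProp X d ∧
          ∀ (e : AFEnd X) (F : EuclideanSpace ℝ (Fin 1) → InitialDataSet (𝓡 3) X),
            IsTameDataFamily e 1 F → IsImmersedAtZero 1 F → F 0 = d → Injective F →
              (∀ c, F c ∈ admissibleVacuumData X) → ∃ c, c ≠ 0 ∧ ¬ HandoffProp X (F c) := by
  rw [modulatedKerrHandoff_iff]
  simp only [not_forall]
  constructor
  · rintro ⟨X, i1, i2, i3, i4, i5, i6, h⟩
    exact ⟨X, i1, i2, i3, i4, i5, i6, (not_isTameGeneric_iff_exists_trapped _).1 h⟩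
  · rintro ⟨X, i1, i2, i3, i4, i5, i6, h⟩
    exact ⟨X, i1, i2, i3, i4, i5, i6, (not_isTameGeneric_iff_exists_trapped _).2 h⟩

/-- **SUFFICIENT FOR A KILL (pointwise form)**: a `Σ` whose admissible class is nonempty and consists of
exceptional data only. On `ℝ³` (`admissibleVacuumData Minkowski.slice ∋ trivialData`): if NO admissible
datum on `ℝ³` has `HandoffProp`, the crux is false. [cite: Christodoulou1999, p. A24] -/
theorem not_modulatedKerrHandoff_of_forall_not
    (h : ∀ D ∈ admissibleVacuumData Minkowski.slice, ¬ HandoffProp Minkowski.slice D) :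
    ¬ ModulatedKerrHandoff := fun hH ↦
  not_isTameGeneric_of_forall_not _ trivialData_mem_admissibleVacuumData h (hH Minkowski.slice)

/-- **Codim-`1` tame genericity on a nonempty class produces a GOOD admissible datum**: H′ implies that
SOME admissible datum on `ℝ³` has the handoff property (the witness curve through an exceptional
trivial datum would consist of good data off `0`; or the trivial datum is good itself).
[cite: Christodoulou1999, p. A24] -/
theorem exists_handoffProp_of_modulatedKerrHandoff (h : ModulatedKerrHandoff) :
    ∃ D ∈ admissibleVacuumData Minkowski.slice, HandoffProp Minkowski.slice D := by
  by_contra hcon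
  push Not at hcon
  exact not_modulatedKerrHandoff_of_forall_not hcon h

/-- **In particular H′ implies an instance of Choquet-Bruhat–Geroch MGHD EXISTENCE together with the
full sixteen-clause package on every MGHD of that datum** (no maximal vacuum Cauchy development of any
datum is constructed in the tree: MGHD theory and the asymptotic analysis are load-bearing, no proof
by bookkeeping). [cite: ChoquetBruhatGeroch1969CMP, p. 330] -/
theorem exists_isMaximal_handoffN_of_modulatedKerrHandoff (h : ModulatedKerrHandoff) :
    ∃ D ∈ admissibleVacuumData Minkowski.slice, ∃ 𝒟 : VacuumCauchyDevelopment D, 𝒟.IsMaximal ∧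
      _root_.Summit.FinalStateConjecture.HasCompleteNullInfinity 𝒟.toCauchyDevelopment ∧
        ∃ N, HandoffN 𝒟 N := by
  obtain ⟨D, hD, ⟨𝒟, h𝒟⟩, hall⟩ := exists_handoffProp_of_modulatedKerrHandoff h
  exact ⟨D, hD, 𝒟, h𝒟, hall 𝒟 h𝒟⟩

/-! ## §2 Load-bearing hypotheses at the crux's own property (mutation analysis) -/

/-- **(a) THE VACUUM-CONSTRAINT CLAUSE OF ADMISSIBILITY IS LOAD-BEARING: without it H′ is FALSE.**
The statement negated is the crux with `D.IsVacuumConstraintSolution` deleted from the admissible class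
(`admissibleNoConstraint`, everything else verbatim); it refines the constraint-free censorship statement, which fails at the trapped
datum `bumpData = (ℝ³, δ, ψ(|y|²)δ)` (Hamiltonian constraint `6` at the origin, continuous along every
jointly smooth curve, so all nearby members have NO vacuum Cauchy development;
`wcc_false_without_constraints`), and tame genericity forgets to plain genericity.
[cite: Christodoulou1999, p. A24] [cite: ChoquetBruhat2009, Ch. VI, Thm. 3.3] -/
theorem modulatedKerrHandoff_false_without_constraints :
    ¬ ∀ (X : Type) [TopologicalSpace X] [ChartedSpace E3 X] [IsManifold (𝓡 3) ∞ X] [T2Space X]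
      [SecondCountableTopology X] [ConnectedSpace X],
      IsTameChristodoulouGeneric (admissibleNoConstraint X) (HandoffProp X) 1 :=
  fun h ↦ wcc_false_without_constraints fun X _ _ _ _ _ _ ↦
    ((h X).mono fun _ _ hP ↦ wccProp_of_handoffProp hP).isChristodoulouGeneric

/-- **(b) `[T2Space Σ]` IS LOAD-BEARING (degenerately)**: the `T2`-free crux (the statement negated:
`[T2Space Σ]` deleted, everything else verbatim) is false as soon as ONE
non-Hausdorff connected second-countable `3`-manifold carries an admissible datum (`ℝ³` with a
doubled origin and the flat data; not constructed in the tree): on such a `Σ` no datum has a data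
embedding into a (Hausdorff) spacetime, so every datum is exceptional and no curve escapes
(transfer of `wccWithoutT2_false_of`). [cite: ChoquetBruhatGeroch1969CMP, p. 330] -/
theorem modulatedKerrHandoffWithoutT2_false_of
    (H : ∃ (Y : Type) (_ : TopologicalSpace Y) (_ : ChartedSpace E3 Y) (_ : IsManifold (𝓡 3) ∞ Y)
      (_ : SecondCountableTopology Y) (_ : ConnectedSpace Y),
      ¬ T2Space Y ∧ (admissibleVacuumData Y).Nonempty) :
    ¬ ∀ (X : Type) [TopologicalSpace X] [ChartedSpace E3 X] [IsManifold (𝓡 3) ∞ X]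
      [SecondCountableTopology X] [ConnectedSpace X],
      IsTameChristodoulouGeneric (admissibleVacuumData X) (HandoffProp X) 1 :=
  fun h ↦ wccWithoutT2_false_of H fun X _ _ _ _ _ ↦
    ((h X).mono fun _ _ hP ↦ wccProp_of_handoffProp hP).isChristodoulouGeneric

/-- **(c) `IsMaximal` IS LOAD-BEARING, step 1 (outright): with it dropped, the trivial datum is
exceptional** — the time-truncated Minkowski space `{x⁰ < 1}` is a vacuum Cauchy development of
`(ℝ³, δ, 0)` with INCOMPLETE `𝓘⁺` in the sojourn form
(`WeakCosmicCensorshipMGHD/Negative/TruncatedMinkowski.lean`). [cite: Christodoulou1999, p. A27] -/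
theorem trivialData_exceptional_without_isMaximal :
    ¬ ((∃ 𝒟 : VacuumCauchyDevelopment trivialData, 𝒟.IsMaximal) ∧
        ∀ 𝒟 : VacuumCauchyDevelopment trivialData,
          _root_.Summit.FinalStateConjecture.HasCompleteNullInfinity 𝒟.toCauchyDevelopment ∧
            ∃ N, HandoffN 𝒟 N) := by
  rintro ⟨-, hall⟩
  obtain ⟨𝒟, h𝒟⟩ := exists_vacuumCauchyDevelopment_trivialData_not_complete
  exact h𝒟 (hall 𝒟).1

/-- **(c) `IsMaximal` IS LOAD-BEARING, step 2**: modulo the (true, here unconstructed) fact that every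
admissible datum on `ℝ³` has SOME vacuum Cauchy development with incomplete future null infinity —
local existence (Choquet-Bruhat 1952) followed by truncation of the development in a Cauchy time
function — the crux with `IsMaximal` dropped from the `∀`-clause (the statement negated: the conclusion asked of
EVERY vacuum Cauchy development; everything else verbatim) is FALSE: every admissible datum on
`ℝ³` is then exceptional, the class is inhabited by `trivialData`, and no curve escapes.
[cite: ChoquetBruhatGeroch1969CMP, p. 330] -/
theorem modulatedKerrHandoff_false_without_isMaximal_of
    (H : ∀ D ∈ admissibleVacuumData Minkowski.slice, ∃ 𝒟 : VacuumCauchyDevelopment D,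
      ¬ _root_.Summit.FinalStateConjecture.HasCompleteNullInfinity 𝒟.toCauchyDevelopment) :
    ¬ ∀ (X : Type) [TopologicalSpace X] [ChartedSpace E3 X] [IsManifold (𝓡 3) ∞ X] [T2Space X]
      [SecondCountableTopology X] [ConnectedSpace X],
      IsTameChristodoulouGeneric (admissibleVacuumData X)
        (fun D ↦ (∃ 𝒟 : VacuumCauchyDevelopment D, 𝒟.IsMaximal) ∧
          ∀ 𝒟 : VacuumCauchyDevelopment D,
            _root_.Summit.FinalStateConjecture.HasCompleteNullInfinity 𝒟.toCauchyDevelopment ∧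
              ∃ N, HandoffN 𝒟 N) 1 := by
  intro hW
  refine not_isTameGeneric_of_forall_not _ trivialData_mem_admissibleVacuumData
    (fun D hD ⟨_, hall⟩ ↦ ?_) (hW Minkowski.slice)
  obtain ⟨𝒟, h𝒟⟩ := H D hD
  exact h𝒟 (hall 𝒟).1

/-! ## §3 The codimension scale -/

/-- **The codimension scale: with parameter `0` in place of `1` the crux is trivially TRUE** — through an
exceptional datum passes the constant `ℝ⁰`-family, tame on the sole end granted by admissibility;
immersion, injectivity and escape are vacuous over the one-point parameter space
(`isTameChristodoulouGeneric_admissible_zero`). All content of H′ sits at `m = 1`.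
[cite: Christodoulou1999, p. A24] -/
theorem modulatedKerrHandoff_scale_zero (X : Type) [TopologicalSpace X] [ChartedSpace E3 X]
    [IsManifold (𝓡 3) ∞ X] [T2Space X] [SecondCountableTopology X] [ConnectedSpace X] :
    IsTameChristodoulouGeneric (admissibleVacuumData X) (HandoffProp X) 0 :=
  isTameChristodoulouGeneric_admissible_zero X _


end Summit.FinalStateConjecture.FinalStateConjecture.Theorems.ModulatedKerrHandoff.Negative

end
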